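import Summits.BirchSwinnertonDyer.BirchSwinnertonDyer.Theorems.QuadraticBranchSignedControlPlusLowerInclusionOfEta
import Summits.BirchSwinnertonDyer.BirchSwinnertonDyer.Theorems.QuadraticBranchSignedControlEtaTransportPlusOfDecomposition
import Literature.NumberTheory.EllipticCurves.Kobayashi2003.SignedSelmerEtaComponentFacts
import HarnessLib

/-!
# Route `QuadraticBranchSignedControl` (rung K8, cell `bsd-potss`): the `η`-SEAM of the even
# main-conjecture block — the `F`-form items 19242 (E⁺|surj), 19114 (C1_η), 19243 (C1_η|non-surj)
# are EQUIVALENT to their print-currency `η`-forms on Kobayashi's object `X⁺(V/K_∞)^η`, granted the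
# descent frame (both directions) and Thm. 1.2 / Thm. 2.2 at `η`

WHAT. The K8 even-main-conjecture block is typed in the cell's `ℚ(√p*)`-SUBTOWER currency — (C1_η)
`QuadraticBranchPlusMainConjectureAt V p` and its Eisenstein half (E⁺) `QuadraticBranchPlusLowerInclusionAt
V p`, both about `X⁺(V/F_∞)` versus `X⁺(V/ℚ_∞)·(L_p⁺(V,η,X))`, `F = ℚ(√p*)` — whereas Kobayashi PRINTS
the conjecture on the `η`-component `X⁺(V/K_∞)^η` of `X⁺(V/ℚ(μ_{p^∞}))` (§4 p. 8: "For every `η`, we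
have `Char(X⁺(E/K_∞)^η) = (L_p⁺(E, η, X))`"), an object the tree HAS (cc-typer-6's
`EtaSignedSelmerDualData V κ K₀ ℚ_[p] η γ 1`). The two currencies differ by the prime-to-`p` DESCENT
FRAME (reading flag `Kob03-MC-eta-quadratic-subtower`, the cell's WANTED piece (i), seats ctrl /
k8q-c3): a `Γ`-equivariant `Φ : Sel⁺(V'/F_∞) ≃ Sel⁺(V/ℚ_∞) × Sel⁺(V/K₀ℚ_∞)^η`. Two forms of the frame
are in use and BOTH are displayed here, verbatim from their owners: the ∀-FORM `hdecA` (for EVERY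
admissible quadratic model `(F, V', κF, γF)` such a `Φ` exists — seat k8q-c2 g0, p420208/p421483) and
the ∃-FORM `hdecE` (SOME admissible model with such a `Φ` exists — seat k8q-c3, p418003). This file
closes the dictionary in the kernel:

* §1 **(E⁺) ⟹ (E⁺_η)** per pair, granted `hdecE` + Thm. 1.2 + Thm. 2.2 at `η`
  (`etaLowerInclusion_of_plusLowerInclusionAt_of_decompositionE`) — NEW: product datum of
  `Sel⁺(V'/F_∞)` on `X⁺(V/ℚ_∞) × D.X` for the GIVEN `η`-datum `D` (k8q-c3's construction), (E⁺) there
  reads `Char X₀ · Char D ⊆ Char X₀ · (Lη)`, and the nonzero principal ideal `Char X₀ = Char X⁺(V/ℚ_∞)`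
  CANCELS in the domain `Λ` (`Ideal.span_singleton_mul_right_mono`); the converse (E⁺_η) ⟹ (E⁺) per
  pair granted `hdecA` is g0's `quadraticBranchPlusLowerInclusionAt_of_etaLowerInclusion_of_decomposition`
  (p421483, imported);
* §2 route level: **`PlusLowerInclusionSurjBranch` (item 19242) ⟺ "(E⁺_η) on every tower-onto good
  `a_p = 0` twist, `p ≥ 5`"** (`plusLowerInclusionSurjBranch_iff_etaLowerInclusion_of_frames`), granted
  both frames + the two finiteness facts (sibling `…PlusEtaMainConjectureSeam.lean`: 19114 / 19243).

The `η`-statements are DISPLAYED as formulas (the node file `Additive/QuadraticBranchPlusEtaNodes.lean`,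
p427065, review-queued, declares them word for word as `@[conjecture] def`s; restating in node currency
is then a `fun`-repackaging). CONSEQUENCE (TARGET R90 option (a)): modulo piece (i) and two printed
finiteness theorems, item 19242 can be carried VERBATIM on Kobayashi's printed object; the ∃-form and
the ∀-form of the frame are what the two directions respectively need.

HONEST FRAMING (cell `bsd-potss`, run/shared/lean/pub/bsd-potss/; FULL-BSD rank ≤ 1 programme, HUMAN
RULING D-0036/D-0074): TOOL THEOREMS ONLY — no definition, no named fact minted, no `sorry`, axioms
standard. Everything is CONDITIONAL on the displayed frames `hdecA` / `hdecE` (WANTED, not proved here)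
and on two NAMED Literature facts in hypothesis position (`Kobayashi2003.thm12_signedSelmerDual_finite_torsion`,
`thm22_etaSignedSelmerDual_finite_torsion`); the conjecture-strength statements appear on BOTH sides of
`↔` and are asserted for no curve; items 19242 / 19114 / 19243 and the route are NOT closed; nothing is
booked; `BSD(W, p)` is claimed for no pair; this is not "finishing BSD". Seat `bsd-potss-k8q-c2`
(prover), g2; `--supports stmt-BirchSwinnertonDyer-19242 --as helper`.

References: [Kobayashi2003] Thm. 1.2 (p. 2), Def. 2.1 + Thm. 2.2 (p. 5), §3 (p. 5), §4 (p. 8);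
[GreenbergLNM1716] §1 (p. 60), §3; [Washington1997] §13.2 (characteristic ideals over `Λ`).
-/

set_option autoImplicit false
set_option linter.dupNamespace false

noncomputable section

open scoped Classical

open CongruenceSubgroup Field WeierstrassCurve
open Literature.NumberTheory.EllipticCurves
open Literature.NumberTheory.EllipticCurves.ModularForms
open Literature.NumberTheory.GaloisRepresentations
open Summit.BirchSwinnertonDyer.Rank1Residual.Additive
open Summit.BirchSwinnertonDyer.Rank1Residual.Additive.SignedTwist
open Summit.BirchSwinnertonDyer.BirchSwinnertonDyer.Theses.QuadraticBranchSignedControl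

namespace Summit.BirchSwinnertonDyer.BirchSwinnertonDyer.Theorems

/-! ## §1 Per pair: (E⁺) ⟹ (E⁺_η) granted the ∃-frame (the converse, granted the ∀-frame, is p421483) -/

/-- **(E⁺) ⟹ (E⁺_η) AT A PAIR, granted the ∃-form frame, Thm. 1.2 and Thm. 2.2 at `η`** (abstract
cyclotomic model `K₀`, quadratic character `ηq` trivial on `Gal(ℚ̄/K₀)`). `hdecE`: for every generator
`γ ∈ Gal(ℚ̄/K₀)` matching the variable there ARE an admissible quadratic model `(F, V', κF, γF)` of
(C1_η) and `Φ : Sel⁺(V'/F_∞) ≃ Sel⁺(V/ℚ_∞) × Sel⁺(V/K₀ℚ_∞)^{ηq}` intertwining `conj_{γF}` with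
`conj_γ` on both factors (k8q-c3's frame, displayed; WANTED); `h12`, `h22`: NAMED facts (Thm. 1.2;
Thm. 2.2 at `η`, through the Literature promotion copy of the `η`-object); `hE`: the `F`-form
Eisenstein inclusion (E⁺) at the pair. Conclusion: for every newform / period ratio / branch function
`Lη` / generator `γ ∈ Gal(ℚ̄/K₀)` / `η`-datum `D`, **`Char(D.X) ⊆ (Lη)`** — (E⁺_η), print currency.
Proof: the product datum `DF` of `Sel⁺(V'/F_∞)` on `X⁺(V/ℚ_∞) × D.X` (character group of a direct
sum); (E⁺) for `(X⁺(V/ℚ_∞), DF)` reads `Char X₀ · Char D ⊆ Char X₀ · (Lη)` by multiplicativity of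
`Char` (torsion: Thm. 1.2, Thm. 2.2 at `η`); `Char X₀ = (a)`, `a ≠ 0`, cancels in the domain `Λ`.
CONDITIONAL; closes nothing.
[cite: Kobayashi2003, Thm. 1.2 (p. 2), Def. 2.1 and Thm. 2.2 (p. 5), §4 Even main conjecture (p. 8)]
[cite: Washington1997, §13.2 (characteristic ideals over Λ; Λ a UFD)] -/
theorem etaLowerInclusion_of_plusLowerInclusionAt_of_decompositionE
    {V : WeierstrassCurve ℚ} [V.IsElliptic] [V.IsGloballyMinimal] {p : ℕ} [Fact p.Prime]
    (h12 : Kobayashi2003.thm12_signedSelmerDual_finite_torsion)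
    (h22 : Kobayashi2003.thm22_etaSignedSelmerDual_finite_torsion)
    (K₀ : Type) [Field K₀] [NumberField K₀] [IsCyclotomicExtension {p} ℚ K₀]
    [(galRange (K := ℚ) K₀).Normal] (ηq : absoluteGaloisGroup ℚ →* ℤˣ)
    (hηK : ∀ σ ∈ galRange (K := ℚ) K₀, ηq σ = 1)
    (hdecE : ∀ (κ : ZpExtension ℚ p) (γ : absoluteGaloisGroup ℚ),
        κ.IsCyclotomic → κ.IsTopGenerator γ → γ ∈ galRange (K := ℚ) K₀ →
        IsCyclotomicVariable p γ →
      ∃ (F : Type) (_ : Field F) (_ : NumberField F) (V' : WeierstrassCurve F) (_ : V'.IsElliptic)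
        (κF : ZpExtension F p) (γF : absoluteGaloisGroup F)
        (Φ : Kobayashi2003.signedSelmerInfty V' κF 1 ≃+
          Kobayashi2003.signedSelmerInfty V κ 1 × towerSignedSelmerInftyEta V κ K₀ ℚ_[p] ηq 1),
        Module.finrank ℚ F = 2 ∧ (∃ θ : F, θ ^ 2 = algebraMap ℚ F ((-1) ^ (p / 2) * p)) ∧
        (∃ C : VariableChange F, C • V.baseChange F = V') ∧
        κF.IsCyclotomic ∧ κF.IsTopGenerator γF ∧
        (∃ ζ : ℤ_[p]ˣ, IsOfFinOrder ζ ∧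
          ((GaloisRep.cyclotomicCharacter F p γF * ζ : ℤ_[p]ˣ) : ℤ_[p]) =
            (cyclotomicGenerator p : ℤ_[p])) ∧
        ∀ s : Kobayashi2003.signedSelmerInfty V' κF 1,
          ((Φ ⟨V'.conjH1 p κF.kerSubgroup γF s,
              Kobayashi2003.conjH1_mem_signedSelmerInfty V' κF 1 γF s.2⟩).1 :
              V.subgroupH1 p κ.kerSubgroup) =
            V.conjH1 p κ.kerSubgroup γ (Φ s).1 ∧
          ((Φ ⟨V'.conjH1 p κF.kerSubgroup γF s,
              Kobayashi2003.conjH1_mem_signedSelmerInfty V' κF 1 γF s.2⟩).2 :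
              V.subgroupH1 p (towerTopSubgroup κ K₀)) =
            V.conjH1 p (towerTopSubgroup κ K₀) γ (Φ s).2)
    (hE : QuadraticBranchPlusLowerInclusionAt V p) :
    ∀ {N : ℕ} [NeZero N] {f : CuspForm (Gamma0 N) 2},
      p ≠ 2 → V.HasGoodReductionAtPrime p → V.frobeniusTrace p = 0 → IsNewformOf V f →
    ∀ (ϖ : ℚ), (if Even (p / 2) then (ϖ : ℝ) * V.realPeriodRat = plusPeriod f
        else (ϖ : ℝ) * V.imaginaryPeriodRat = minusPeriod f) →
    ∀ (Lη : IwasawaAlgebra p), IsQuadraticBranchPlusLFunction f p ϖ Lη →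
    ∀ (κ : ZpExtension ℚ p) (γ : absoluteGaloisGroup ℚ),
      κ.IsCyclotomic → κ.IsTopGenerator γ → γ ∈ galRange (K := ℚ) K₀ →
      IsCyclotomicVariable p γ →
    ∀ (D : EtaSignedSelmerDualData V κ K₀ ℚ_[p] ηq γ 1), D.charIdeal ≤ Ideal.span {Lη} := by
  intro N _ f hp2 hgood hap hf ϖ hϖ Lη hL κ γ hκ hγ hγK hγc D
  obtain ⟨F, _instF, _instNF, V', _instE, κF, γF, Φ, hF2, hθ, hCV, hκF, hγF, hζ, hΦ⟩ :=
    hdecE κ γ hκ hγ hγK hγc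
  -- Kobayashi's dual datum of `Sel⁺(V/ℚ_∞)` at `γ` (EXISTS)
  let D₀ : Kobayashi2003.SignedSelmerDualData V κ γ 1 := Kobayashi2003.signedSelmerDualData V κ 1 hγ
  -- the character group of the direct sum
  let π₀ : Kobayashi2003.signedSelmerInfty V' κF 1 →+ Kobayashi2003.signedSelmerInfty V κ 1 :=
    (AddMonoidHom.fst _ _).comp Φ.toAddMonoidHom
  let π₁ : Kobayashi2003.signedSelmerInfty V' κF 1 →+ towerSignedSelmerInftyEta V κ K₀ ℚ_[p] ηq 1 :=
    (AddMonoidHom.snd _ _).comp Φ.toAddMonoidHom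
  let T : D₀.X × D.X →+ (Kobayashi2003.signedSelmerInfty V' κF 1 →+ AddCircle (1 : ℚ)) :=
    AddMonoidHom.mk' (fun x => (D₀.toDual x.1).comp π₀ + (D.toDual x.2).comp π₁) (by
      intro x y
      simp only [Prod.fst_add, Prod.snd_add, map_add, AddMonoidHom.add_comp]
      abel)
  have hT : ∀ (x : D₀.X × D.X) (s : Kobayashi2003.signedSelmerInfty V' κF 1),
      T x s = D₀.toDual x.1 (Φ s).1 + D.toDual x.2 (Φ s).2 := fun x s => rfl
  have hTbij : Function.Bijective T :=
    bijective_dualOfProd Φ D₀.toDual D.toDual D₀.bijective D.bijective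
  -- the product datum of `Sel⁺(V'/F_∞)` at `γF` on the module `D₀.X × D.X`
  let DF : Kobayashi2003.SignedSelmerDualData V' κF γF 1 :=
    { X := D₀.X × D.X
      conj_mem := fun s hs => Kobayashi2003.conjH1_mem_signedSelmerInfty V' κF 1 γF hs
      toDual := T
      bijective := hTbij
      toDual_T_smul := by
        intro x s
        have h0 : (Φ ⟨V'.conjH1 p κF.kerSubgroup γF s,
            Kobayashi2003.conjH1_mem_signedSelmerInfty V' κF 1 γF s.2⟩).1 =
            ⟨V.conjH1 p κ.kerSubgroup γ (Φ s).1, D₀.conj_mem _ (Φ s).1.2⟩ :=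
          Subtype.ext (hΦ s).1
        have h1 : (Φ ⟨V'.conjH1 p κF.kerSubgroup γF s,
            Kobayashi2003.conjH1_mem_signedSelmerInfty V' κF 1 γF s.2⟩).2 =
            ⟨V.conjH1 p (towerTopSubgroup κ K₀) γ (Φ s).2, D.conj_mem _ (Φ s).2.2⟩ :=
          Subtype.ext (hΦ s).2
        rw [hT, hT, hT, Prod.smul_fst, Prod.smul_snd, D₀.toDual_T_smul, D.toDual_T_smul, h0, h1]
        abel
      toDual_C_smul := by
        intro c x s k hk
        have hk' : (p ^ k) • Φ s = 0 := by rw [← map_nsmul, hk, map_zero]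
        have hk0 : (p ^ k) • (Φ s).1 = 0 := by
          have h := congrArg Prod.fst hk'
          rwa [Prod.smul_fst, Prod.fst_zero] at h
        have hk1 : (p ^ k) • (Φ s).2 = 0 := by
          have h := congrArg Prod.snd hk'
          rwa [Prod.smul_snd, Prod.snd_zero] at h
        rw [hT, hT, Prod.smul_fst, Prod.smul_snd, D₀.toDual_C_smul c x.1 _ k hk0,
          D.toDual_C_smul c x.2 _ k hk1, smul_add] }
  -- (E⁺) at the quadratic model, for `(D₀, DF)`: `Char(D₀.X × D.X) ⊆ Char D₀.X · (Lη)`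
  have hEF : Module.charIdeal (IwasawaAlgebra p) (D₀.X × D.X) ≤
      Module.charIdeal (IwasawaAlgebra p) D₀.X * Ideal.span {Lη} :=
    hE F V' hp2 hgood hap hF2 hθ hCV hκ hγ hγc hκF hγF hζ hf ϖ hϖ Lη hL D₀ DF
  -- torsion: Thm. 1.2 for `D₀`, Thm. 2.2 at `η` for `D` (through the promotion copy)
  obtain ⟨hD0fin, hD0tor⟩ := h12 V p hp2 hgood hap κ γ hκ hγ 1 D₀
  let D' : Literature.NumberTheory.EllipticCurves.Kobayashi2003.EtaSignedSelmerDualData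
      V κ K₀ ℚ_[p] ηq γ 1 :=
    { X := D.X
      conj_mem := D.conj_mem
      toDual := D.toDual
      bijective := D.bijective
      toDual_T_smul := D.toDual_T_smul
      toDual_C_smul := D.toDual_C_smul }
  obtain ⟨hDfin, hDtor⟩ := h22 p K₀ ηq hηK V hp2 hgood hap κ γ hκ hγ hγK 1 D'
  haveI : Module.Finite (IwasawaAlgebra p) D₀.X := hD0fin
  haveI : Module.Finite (IwasawaAlgebra p) D.X := hDfin
  have hPtor : Module.IsTorsion (IwasawaAlgebra p) (D₀.X × D.X) :=
    isTorsion_prod_of_isTorsion hD0tor hDtor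
  have hPchar : Module.charIdeal (IwasawaAlgebra p) (D₀.X × D.X) =
      Module.charIdeal (IwasawaAlgebra p) D₀.X * Module.charIdeal (IwasawaAlgebra p) D.X :=
    charIdeal_mul_of_shortExact_holds p (D₀.X × D.X) hPtor
      (LinearMap.inl (IwasawaAlgebra p) D₀.X D.X) (LinearMap.snd (IwasawaAlgebra p) D₀.X D.X)
      LinearMap.inl_injective LinearMap.snd_surjective .inl_snd
  -- cancellation of the nonzero principal ideal `Char D₀.X` in the domain `Λ`
  obtain ⟨a, ha⟩ := (charIdeal_isPrincipal_holds p D₀.X).principal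
  have ha' : Module.charIdeal (IwasawaAlgebra p) D₀.X = Ideal.span {a} := ha
  have ha0 : a ≠ 0 := by
    intro h
    apply Module.charIdeal_ne_bot (IwasawaAlgebra p) D₀.X
    rw [ha', h, Ideal.span_singleton_eq_bot]
  rw [hPchar, ha'] at hEF
  exact (Ideal.span_singleton_mul_right_mono ha0).mp hEF

/-! ## §2 Route level: item 19242 ⟺ (E⁺_η) on the tower-onto twists, granted both frames -/

/-- **Item 19242 `PlusLowerInclusionSurjBranch` ⟺ «(E⁺_η) for every tower-onto good `a_p = 0` twist
`V`, `p ≥ 5`», granted BOTH forms of the descent frame and Thm. 1.2 / Thm. 2.2 at `η`.** Hypotheses,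
all displayed: `h12`, `h22` (NAMED facts); `hdecA` (∀-form frame, for every `p ≥ 5`, cyclotomic `K₀`,
quadratic `ηq`, good `a_p = 0` twist `V`, generator `γ ∈ Gal(ℚ̄/K₀)` matching the variable and every
admissible model — g0's text); `hdecE` (∃-form frame: same prefix, SOME admissible model with `Φ` —
k8q-c3's text). Right-hand side: for every such `p, K₀, ηq, V` with `ρ_{V,p^m}` onto for all `m`,
newform `f`, period ratio `ϖ`, branch function `Lη`, generator `γ ∈ Gal(ℚ̄/K₀)` and `η`-datum `D`:
`Char(D.X) ⊆ (Lη)` — the Eisenstein half of Kobayashi's printed even main conjecture at `η` (the body of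
the node `QuadraticBranchPlusEtaLowerInclusionAt`, p427065). ⟹: §1 with `hdecE`; ⟸: g0's theorem (p421483) with
`hdecA` (`K₀ := ℚ(ζ_p)`, `η` from `exists_theta_eta_cyclotomicField`). CONDITIONAL; closes nothing.
[cite: Kobayashi2003, Thm. 1.2 (p. 2), Thm. 2.2 (p. 5), §4 Even main conjecture (p. 8), §3 (p. 5)]
[cite: GreenbergLNM1716, §1 (p. 60) and §3 (descent in prime-to-p extensions; reading)] -/
theorem plusLowerInclusionSurjBranch_iff_etaLowerInclusion_of_frames
    (h12 : Kobayashi2003.thm12_signedSelmerDual_finite_torsion)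
    (h22 : Kobayashi2003.thm22_etaSignedSelmerDual_finite_torsion)
    (hdecA : ∀ (p : ℕ) [Fact p.Prime], 5 ≤ p →
      ∀ (K₀ : Type) [Field K₀] [NumberField K₀] [IsCyclotomicExtension {p} ℚ K₀]
        [(galRange (K := ℚ) K₀).Normal] (ηq : absoluteGaloisGroup ℚ →* ℤˣ),
        (∀ σ ∈ galRange (K := ℚ) K₀, ηq σ = 1) → ηq ≠ 1 →
      ∀ (V : WeierstrassCurve ℚ) [V.IsElliptic] [V.IsGloballyMinimal],
        V.HasGoodReductionAtPrime p → V.frobeniusTrace p = 0 →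
      ∀ (κ : ZpExtension ℚ p) (γ : absoluteGaloisGroup ℚ),
        κ.IsCyclotomic → κ.IsTopGenerator γ → γ ∈ galRange (K := ℚ) K₀ →
        IsCyclotomicVariable p γ →
      ∀ (F : Type) [Field F] [NumberField F] (V' : WeierstrassCurve F) [V'.IsElliptic]
        (κF : ZpExtension F p) (γF : absoluteGaloisGroup F),
        Module.finrank ℚ F = 2 → (∃ θ : F, θ ^ 2 = algebraMap ℚ F ((-1) ^ (p / 2) * p)) →
        (∃ C : VariableChange F, C • V.baseChange F = V') →
        κF.IsCyclotomic → κF.IsTopGenerator γF →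
        (∃ ζ : ℤ_[p]ˣ, IsOfFinOrder ζ ∧
          ((GaloisRep.cyclotomicCharacter F p γF * ζ : ℤ_[p]ˣ) : ℤ_[p]) =
            (cyclotomicGenerator p : ℤ_[p])) →
      ∃ Φ : Kobayashi2003.signedSelmerInfty V' κF 1 ≃+
          Kobayashi2003.signedSelmerInfty V κ 1 × towerSignedSelmerInftyEta V κ K₀ ℚ_[p] ηq 1,
        ∀ s : Kobayashi2003.signedSelmerInfty V' κF 1,
          ((Φ ⟨V'.conjH1 p κF.kerSubgroup γF s,
              Kobayashi2003.conjH1_mem_signedSelmerInfty V' κF 1 γF s.2⟩).1 :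
              V.subgroupH1 p κ.kerSubgroup) =
            V.conjH1 p κ.kerSubgroup γ (Φ s).1 ∧
          ((Φ ⟨V'.conjH1 p κF.kerSubgroup γF s,
              Kobayashi2003.conjH1_mem_signedSelmerInfty V' κF 1 γF s.2⟩).2 :
              V.subgroupH1 p (towerTopSubgroup κ K₀)) =
            V.conjH1 p (towerTopSubgroup κ K₀) γ (Φ s).2)
    (hdecE : ∀ (p : ℕ) [Fact p.Prime], 5 ≤ p →
      ∀ (K₀ : Type) [Field K₀] [NumberField K₀] [IsCyclotomicExtension {p} ℚ K₀]
        [(galRange (K := ℚ) K₀).Normal] (ηq : absoluteGaloisGroup ℚ →* ℤˣ),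
        (∀ σ ∈ galRange (K := ℚ) K₀, ηq σ = 1) → ηq ≠ 1 →
      ∀ (V : WeierstrassCurve ℚ) [V.IsElliptic] [V.IsGloballyMinimal],
        V.HasGoodReductionAtPrime p → V.frobeniusTrace p = 0 →
      ∀ (κ : ZpExtension ℚ p) (γ : absoluteGaloisGroup ℚ),
        κ.IsCyclotomic → κ.IsTopGenerator γ → γ ∈ galRange (K := ℚ) K₀ →
        IsCyclotomicVariable p γ →
      ∃ (F : Type) (_ : Field F) (_ : NumberField F) (V' : WeierstrassCurve F) (_ : V'.IsElliptic)
        (κF : ZpExtension F p) (γF : absoluteGaloisGroup F)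
        (Φ : Kobayashi2003.signedSelmerInfty V' κF 1 ≃+
          Kobayashi2003.signedSelmerInfty V κ 1 × towerSignedSelmerInftyEta V κ K₀ ℚ_[p] ηq 1),
        Module.finrank ℚ F = 2 ∧ (∃ θ : F, θ ^ 2 = algebraMap ℚ F ((-1) ^ (p / 2) * p)) ∧
        (∃ C : VariableChange F, C • V.baseChange F = V') ∧
        κF.IsCyclotomic ∧ κF.IsTopGenerator γF ∧
        (∃ ζ : ℤ_[p]ˣ, IsOfFinOrder ζ ∧
          ((GaloisRep.cyclotomicCharacter F p γF * ζ : ℤ_[p]ˣ) : ℤ_[p]) =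
            (cyclotomicGenerator p : ℤ_[p])) ∧
        ∀ s : Kobayashi2003.signedSelmerInfty V' κF 1,
          ((Φ ⟨V'.conjH1 p κF.kerSubgroup γF s,
              Kobayashi2003.conjH1_mem_signedSelmerInfty V' κF 1 γF s.2⟩).1 :
              V.subgroupH1 p κ.kerSubgroup) =
            V.conjH1 p κ.kerSubgroup γ (Φ s).1 ∧
          ((Φ ⟨V'.conjH1 p κF.kerSubgroup γF s,
              Kobayashi2003.conjH1_mem_signedSelmerInfty V' κF 1 γF s.2⟩).2 :
              V.subgroupH1 p (towerTopSubgroup κ K₀)) =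
            V.conjH1 p (towerTopSubgroup κ K₀) γ (Φ s).2) :
    PlusLowerInclusionSurjBranch ↔
      ∀ (p : ℕ) [Fact p.Prime], 5 ≤ p →
      ∀ (K₀ : Type) [Field K₀] [NumberField K₀] [IsCyclotomicExtension {p} ℚ K₀]
        [(galRange (K := ℚ) K₀).Normal] (ηq : absoluteGaloisGroup ℚ →* ℤˣ),
        (∀ σ ∈ galRange (K := ℚ) K₀, ηq σ = 1) → ηq ≠ 1 →
      ∀ (V : WeierstrassCurve ℚ) [V.IsElliptic] [V.IsGloballyMinimal] {N : ℕ} [NeZero N]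
        {f : CuspForm (Gamma0 N) 2},
        p ≠ 2 → V.HasGoodReductionAtPrime p → V.frobeniusTrace p = 0 →
        (∀ m : ℕ, V.HasSurjectiveModNGaloisRep (p ^ m : ℕ)) → IsNewformOf V f →
      ∀ (ϖ : ℚ), (if Even (p / 2) then (ϖ : ℝ) * V.realPeriodRat = plusPeriod f
          else (ϖ : ℝ) * V.imaginaryPeriodRat = minusPeriod f) →
      ∀ (Lη : IwasawaAlgebra p), IsQuadraticBranchPlusLFunction f p ϖ Lη →
      ∀ (κ : ZpExtension ℚ p) (γ : absoluteGaloisGroup ℚ),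
        κ.IsCyclotomic → κ.IsTopGenerator γ → γ ∈ galRange (K := ℚ) K₀ →
        IsCyclotomicVariable p γ →
      ∀ (D : EtaSignedSelmerDualData V κ K₀ ℚ_[p] ηq γ 1), D.charIdeal ≤ Ideal.span {Lη} := by
  constructor
  · intro h p _ hp5 K₀ _ _ _ _ ηq hηK hη1 V _ _ N _ f hp2 hgood hap hsurj hf ϖ hϖ Lη hL κ γ hκ hγ
      hγK hγc D
    exact etaLowerInclusion_of_plusLowerInclusionAt_of_decompositionE h12 h22 K₀ ηq hηK
      (fun κ γ hκ hγ hγK hγc => hdecE p hp5 K₀ ηq hηK hη1 V hgood hap κ γ hκ hγ hγK hγc)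
      (h V p hp5 hgood hap hsurj) hp2 hgood hap hf ϖ hϖ Lη hL κ γ hκ hγ hγK hγc D
  · intro h V _ _ p _ hp5 hgood hap hsurj
    have hp2 : p ≠ 2 := by omega
    haveI : NeZero p := ⟨(Fact.out : p.Prime).ne_zero⟩
    haveI : IsCyclotomicExtension {p} ℚ (CyclotomicField p ℚ) :=
      CyclotomicField.isCyclotomicExtension p ℚ
    haveI : (galRange (K := ℚ) (CyclotomicField p ℚ)).Normal := normal_galRange_cyclotomic p _
    obtain ⟨θ, ηq, -, -, -, hηK, hη1⟩ := exists_theta_eta_cyclotomicField p hp2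
    exact quadraticBranchPlusLowerInclusionAt_of_etaLowerInclusion_of_decomposition h12 h22
      (CyclotomicField p ℚ) ηq hηK
      (fun κ γ hκ hγ hγK hγc F _ _ V' _ κF γF hF hθ hC hκF hγF hζ =>
        hdecA p hp5 (CyclotomicField p ℚ) ηq hηK hη1 V hgood hap κ γ hκ hγ hγK hγc F V' κF γF hF hθ
          hC hκF hγF hζ)
      (fun hp2' hgood' hap' hf ϖ hϖ Lη hL κ γ hκ hγ hγK hγc D =>
        h p hp5 (CyclotomicField p ℚ) ηq hηK hη1 V hp2' hgood' hap' hsurj hf ϖ hϖ Lη hL κ γ hκ hγ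
          hγK hγc D)

end Summit.BirchSwinnertonDyer.BirchSwinnertonDyer.Theorems

end
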